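import Summits.Ventures.Crystal3D.Theorems.StickyWulffConstantStackingLiminfOptimalProfileBound
import Summits.Ventures.Crystal3D.Theorems.StickyWulffConstantStackingLiminfCalibratedRung
import HarnessLib

/-!
# The EXACT-CEILING rungs `∛(1017/4 + 54√3) = 7.0324` (from `layerProfile`) and
# `∛(531/2 + 54√6) = 7.3544` (from `layerProfileSharp`) of the word-uniform layer-profile ladder —
# crux `StackingLiminf` (stmt-Ventures-19145), cf-p2 R20 optimal calibration

Route `StickyWulffConstant` of the venture `Summits/Ventures/Crystal3D` (cell `crystal3d-full`).
From `profile_bound_opt` (`…OptimalProfileBound.lean`): for every Hägg word `σ` and every injective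
`N`-configuration on `barlowStacking 1 √(2/3) σ`,
`numContacts ≤ 6N − min(3N/5, 3N^{3/4} − 8√N, (1017/4 + 54√3)^{1/3}·N^{2/3} − 8√N)`
(input `layerProfile`, `(c,δ) = (1,0)`; `numContacts_le_opt_one`) and
`numContacts ≤ 6N − min(3N/5, 3N^{3/4} − 8√N, (531/2 + 54√6)^{1/3}·N^{2/3} − 8√N)`
(input `layerProfileSharp`, `(c,δ) = (√2, 1/2)`; `numContacts_le_opt_sqrt2`), hence the ε-forms
`stackingLiminf_rung_opt_one` (`∛347.78 = 7.0324`) and `stackingLiminf_rung_opt_sqrt2`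
(`∛397.77 = 7.3544` = 97.3 % of the crux's `∛432 = 7.5595`), uniformly in `σ`.  These are the
EXACT CEILINGS of the layer-profile ladder certified by cf-p2 R20 (kit j262960/j263200/j262988,
`(c*_c)³ = 243 + 54√3·c + 45c²/4`; blueprint = evidence #15, sorry-free Lean companion = evidence
#18 on stmt-Ventures-19145): the calibration cannot be improved within the hypotheses
(H)+(T)+(S_c) of `layerProfile`/`layerProfileSharp` (R20 §1, lineage B exact DP).  Landed before:
`∛320 = 6.84` (p462749), `∛338 / ∛369 = 7.173` (p487373).
WHAT THIS IS NOT: `StackingLiminf` (∛432 needs input beyond the layer-profile ladder: R20 §6 —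
a joint per-layer inequality, or sliceDomination + chimera); nothing about which stacking is
optimal; rung F-C1 not moved.
-/

noncomputable section

namespace Summit.Ventures.Crystal3D.Theorems.OptimalCalibration

open Finset
open Literature.MathematicalPhysics.StatisticalMechanics (barlowStacking IsHaggSeq)
open Summit.Ventures.Crystal3D.Theorems

/-! ### Arithmetic of the thresholds -/

/-- `K^{1/3}·N^{2/3} ≤ 3·N^{3/4}` once `K⁴ ≤ 3¹²·N` (raise both sides to the 12th power). -/
theorem cbrt_rpow_le_three_rpow34 {K N : ℝ} (hK : 0 ≤ K) (hN0 : 0 ≤ N) (hN : K ^ 4 ≤ 3 ^ 12 * N) :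
    K ^ ((1 : ℝ) / 3) * N ^ ((2 : ℝ) / 3) ≤ 3 * N ^ ((3 : ℝ) / 4) := by
  have h1 : (K ^ ((1 : ℝ) / 3) * N ^ ((2 : ℝ) / 3)) ^ (12 : ℕ) = K ^ 4 * N ^ 8 := by
    rw [mul_pow, ← Real.rpow_natCast, ← Real.rpow_natCast (N ^ ((2 : ℝ) / 3)),
      ← Real.rpow_mul hK, ← Real.rpow_mul hN0]
    norm_num
  have h2 : (3 * N ^ ((3 : ℝ) / 4)) ^ (12 : ℕ) = 3 ^ 12 * N ^ 9 := by
    rw [mul_pow, ← Real.rpow_natCast (N ^ ((3 : ℝ) / 4)), ← Real.rpow_mul hN0]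
    norm_num
  have h3 : K ^ 4 * N ^ 8 ≤ 3 ^ 12 * N ^ 9 := by
    have := mul_le_mul_of_nonneg_right hN (by positivity : (0 : ℝ) ≤ N ^ 8)
    nlinarith
  have h4 : (K ^ ((1 : ℝ) / 3) * N ^ ((2 : ℝ) / 3)) ^ (12 : ℕ) ≤ (3 * N ^ ((3 : ℝ) / 4)) ^ (12 : ℕ) := by
    rw [h1, h2]; exact h3
  exact (pow_le_pow_iff_left₀ (by positivity) (by positivity) (by norm_num : (12 : ℕ) ≠ 0)).1 h4

/-- Numerical bound for the `√N`-coefficient at `(c, δ) = (1, 0)`: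
`κ + K' = √3/(2√31) + 1 + 2√3 + 4(2√3 + 1)/√31 ≤ 8` (`= 7.83`). -/
theorem coeff_one_le :
    0 + Real.sqrt 3 / (2 * Real.sqrt 31) +
        (1 + 2 * Real.sqrt 3 / 1 + 4 * (2 * Real.sqrt 3 + 1) / (1 * Real.sqrt 31)) ≤ 8 := by
  have sqrt3_le : Real.sqrt 3 ≤ 1.73206 := by
    rw [show (1.73206 : ℝ) = Real.sqrt (1.73206 ^ 2) by rw [Real.sqrt_sq (by norm_num)]]
    exact Real.sqrt_le_sqrt (by norm_num)
  have sqrt31_ge : (5.5677 : ℝ) ≤ Real.sqrt 31 := by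
    rw [show (5.5677 : ℝ) = Real.sqrt (5.5677 ^ 2) by rw [Real.sqrt_sq (by norm_num)]]
    exact Real.sqrt_le_sqrt (by norm_num)
  have hs31 : 0 < Real.sqrt 31 := by linarith
  have hs3 : 0 ≤ Real.sqrt 3 := Real.sqrt_nonneg _
  have p1 : Real.sqrt 3 / (2 * Real.sqrt 31) ≤ 0.156 := by
    rw [div_le_iff₀ (by positivity)]; nlinarith
  have p2 : 4 * (2 * Real.sqrt 3 + 1) / (1 * Real.sqrt 31) ≤ 3.21 := by
    rw [div_le_iff₀ (by positivity)]; nlinarith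
  rw [div_one]
  linarith

/-- Numerical bound for the `√N`-coefficient at `(c, δ) = (√2, 1/2)`:
`κ + K' = 1/2 + √3/(2√31) + √2 + 2√3/√2 + 4(2√3 + √2)/(√2√31) ≤ 8` (`= 6.997`). -/
theorem coeff_sqrt2_le :
    1 / 2 + Real.sqrt 3 / (2 * Real.sqrt 31) +
        (Real.sqrt 2 + 2 * Real.sqrt 3 / Real.sqrt 2 +
          4 * (2 * Real.sqrt 3 + Real.sqrt 2) / (Real.sqrt 2 * Real.sqrt 31)) ≤ 8 := by
  have sqrt3_le : Real.sqrt 3 ≤ 1.73206 := by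
    rw [show (1.73206 : ℝ) = Real.sqrt (1.73206 ^ 2) by rw [Real.sqrt_sq (by norm_num)]]
    exact Real.sqrt_le_sqrt (by norm_num)
  have sqrt2_ge : (1.41421 : ℝ) ≤ Real.sqrt 2 := by
    rw [show (1.41421 : ℝ) = Real.sqrt (1.41421 ^ 2) by rw [Real.sqrt_sq (by norm_num)]]
    exact Real.sqrt_le_sqrt (by norm_num)
  have sqrt2_le : Real.sqrt 2 ≤ 1.41422 := by
    rw [show (1.41422 : ℝ) = Real.sqrt (1.41422 ^ 2) by rw [Real.sqrt_sq (by norm_num)]]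
    exact Real.sqrt_le_sqrt (by norm_num)
  have sqrt31_ge : (5.5677 : ℝ) ≤ Real.sqrt 31 := by
    rw [show (5.5677 : ℝ) = Real.sqrt (5.5677 ^ 2) by rw [Real.sqrt_sq (by norm_num)]]
    exact Real.sqrt_le_sqrt (by norm_num)
  have hs31 : 0 < Real.sqrt 31 := by linarith
  have hs2 : 0 < Real.sqrt 2 := by linarith
  have hs3 : 0 ≤ Real.sqrt 3 := Real.sqrt_nonneg _
  have p1 : Real.sqrt 3 / (2 * Real.sqrt 31) ≤ 0.156 := by
    rw [div_le_iff₀ (by positivity)]; nlinarith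
  have p2 : 2 * Real.sqrt 3 / Real.sqrt 2 ≤ 2.46 := by
    rw [div_le_iff₀ hs2]; nlinarith
  have p3 : 4 * (2 * Real.sqrt 3 + Real.sqrt 2) / (Real.sqrt 2 * Real.sqrt 31) ≤ 2.48 := by
    rw [div_le_iff₀ (by positivity)]; nlinarith [mul_le_mul sqrt2_ge sqrt31_ge (by norm_num) hs2.le]
  linarith

/-- The ceiling constant at `c = 1`: `243 + 54√3·1 + 45·1²/4 = 1017/4 + 54√3` (`= 347.78`). -/
theorem ceiling_one : (243 + 54 * Real.sqrt 3 * 1 + 45 * (1 : ℝ) ^ 2 / 4) = 1017 / 4 + 54 * Real.sqrt 3 := by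
  ring

/-- The ceiling constant at `c = √2`: `243 + 54√3·√2 + 45·(√2)²/4 = 531/2 + 54√6` (`= 397.77`). -/
theorem ceiling_sqrt2 :
    (243 + 54 * Real.sqrt 3 * Real.sqrt 2 + 45 * Real.sqrt 2 ^ 2 / 4) = 531 / 2 + 54 * Real.sqrt 6 := by
  have h2 : Real.sqrt 2 ^ 2 = 2 := Real.sq_sqrt (by norm_num)
  have h6 : Real.sqrt 6 = Real.sqrt 3 * Real.sqrt 2 := by
    rw [show (6 : ℝ) = 3 * 2 by norm_num, Real.sqrt_mul (by norm_num)]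
  rw [h2, h6]; ring

/-- `1017/4 + 54√3 ≤ 348`. -/
theorem ceiling_one_le : 1017 / 4 + 54 * Real.sqrt 3 ≤ (348 : ℝ) := by
  have sqrt3_le : Real.sqrt 3 ≤ 1.73206 := by
    rw [show (1.73206 : ℝ) = Real.sqrt (1.73206 ^ 2) by rw [Real.sqrt_sq (by norm_num)]]
    exact Real.sqrt_le_sqrt (by norm_num)
  linarith

/-- `531/2 + 54√6 ≤ 398`. -/
theorem ceiling_sqrt2_le : 531 / 2 + 54 * Real.sqrt 6 ≤ (398 : ℝ) := by
  have sqrt6_le : Real.sqrt 6 ≤ 2.4495 := by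
    rw [show (2.4495 : ℝ) = Real.sqrt (2.4495 ^ 2) by rw [Real.sqrt_sq (by norm_num)]]
    exact Real.sqrt_le_sqrt (by norm_num)
  linarith

/-! ### The rungs -/

/-- **Exact-ceiling rung from `layerProfile`** (`(c, δ) = (1, 0)`): for every Hägg word `σ` and every
injective configuration on `barlowStacking 1 √(2/3) σ`,
`numContacts x ≤ 6N − min(3N/5, 3N^{3/4} − 8√N, (1017/4 + 54√3)^{1/3}·N^{2/3} − 8√N)`. -/
theorem numContacts_le_opt_one (σ : ℤ → ℤ) (hσ : IsHaggSeq σ) {N : ℕ}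
    (x : Fin N → EuclideanSpace ℝ (Fin 3)) (hx : Function.Injective x)
    (hmem : ∀ i, x i ∈ barlowStacking 1 (Real.sqrt (2 / 3)) σ) :
    (numContacts x : ℝ) ≤ 6 * (N : ℝ) -
      min (3 / 5 * (N : ℝ))
        (min (3 * (N : ℝ) ^ ((3 : ℝ) / 4) - 8 * Real.sqrt N)
          ((1017 / 4 + 54 * Real.sqrt 3) ^ ((1 : ℝ) / 3) * (N : ℝ) ^ ((2 : ℝ) / 3) -
            8 * Real.sqrt N)) := by
  rcases Nat.eq_zero_or_pos N with rfl | hNpos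
  · have h0 : numContacts x = 0 := by
      rw [numContacts, contactPairs, Finset.card_eq_zero, Finset.filter_eq_empty_iff]
      intro p; exact Fin.elim0 p.1
    rw [h0]
    simp [Real.zero_rpow (by norm_num : (2 : ℝ) / 3 ≠ 0), Real.zero_rpow (by norm_num : (3 : ℝ) / 4 ≠ 0)]
  obtain ⟨kmin, kmax, n, d, b, hkk, hsupp, hsum, hd0, hd, hb1, hb2, hC⟩ :=
    layerProfile σ hσ x hx hmem hNpos
  have hb2' : ∀ κ, 1 / 2 * |(n κ : ℝ) - n (κ + 1)| + 1 * Real.sqrt (max (n κ : ℝ) (n (κ + 1))) - 0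
      ≤ b κ := fun κ => by simpa only [one_mul, sub_zero] using hb2 κ
  have h := profile_bound_opt hNpos (c := 1) (δ := 0) one_pos (by norm_num) le_rfl zero_le_one
    (by norm_num) hkk hsupp hsum hd0 hd hb1 hb2' hC
  rw [ceiling_one] at h
  -- compare the `√N` coefficients
  have hsN : 0 ≤ Real.sqrt (N : ℝ) := Real.sqrt_nonneg _
  have hco := coeff_one_le
  have hK'8 : (1 + 2 * Real.sqrt 3 / 1 + 4 * (2 * Real.sqrt 3 + 1) / (1 * Real.sqrt 31)) ≤ 8 := by
    have : 0 ≤ 0 + Real.sqrt 3 / (2 * Real.sqrt 31) := by positivity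
    linarith
  have hm2 : 3 * (N : ℝ) ^ ((3 : ℝ) / 4) - 8 * Real.sqrt N ≤
      3 * (N : ℝ) ^ ((3 : ℝ) / 4) -
        (1 + 2 * Real.sqrt 3 / 1 + 4 * (2 * Real.sqrt 3 + 1) / (1 * Real.sqrt 31)) * Real.sqrt N := by
    nlinarith [mul_le_mul_of_nonneg_right hK'8 hsN]
  have hm3 : (1017 / 4 + 54 * Real.sqrt 3) ^ ((1 : ℝ) / 3) * (N : ℝ) ^ ((2 : ℝ) / 3) - 8 * Real.sqrt N ≤
      (1017 / 4 + 54 * Real.sqrt 3) ^ ((1 : ℝ) / 3) * (N : ℝ) ^ ((2 : ℝ) / 3) -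
        (0 + Real.sqrt 3 / (2 * Real.sqrt 31) +
          (1 + 2 * Real.sqrt 3 / 1 + 4 * (2 * Real.sqrt 3 + 1) / (1 * Real.sqrt 31))) * Real.sqrt N := by
    nlinarith [mul_le_mul_of_nonneg_right hco hsN]
  have hmin := min_le_min (le_refl (3 / 5 * (N : ℝ))) (min_le_min hm2 hm3)
  linarith [hmin, h]

/-- **Exact-ceiling rung from `layerProfileSharp`** (`(c, δ) = (√2, 1/2)`):
`numContacts x ≤ 6N − min(3N/5, 3N^{3/4} − 8√N, (531/2 + 54√6)^{1/3}·N^{2/3} − 8√N)`,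
uniformly in the Hägg word. -/
theorem numContacts_le_opt_sqrt2 (σ : ℤ → ℤ) (hσ : IsHaggSeq σ) {N : ℕ}
    (x : Fin N → EuclideanSpace ℝ (Fin 3)) (hx : Function.Injective x)
    (hmem : ∀ i, x i ∈ barlowStacking 1 (Real.sqrt (2 / 3)) σ) :
    (numContacts x : ℝ) ≤ 6 * (N : ℝ) -
      min (3 / 5 * (N : ℝ))
        (min (3 * (N : ℝ) ^ ((3 : ℝ) / 4) - 8 * Real.sqrt N)
          ((531 / 2 + 54 * Real.sqrt 6) ^ ((1 : ℝ) / 3) * (N : ℝ) ^ ((2 : ℝ) / 3) -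
            8 * Real.sqrt N)) := by
  rcases Nat.eq_zero_or_pos N with rfl | hNpos
  · have h0 : numContacts x = 0 := by
      rw [numContacts, contactPairs, Finset.card_eq_zero, Finset.filter_eq_empty_iff]
      intro p; exact Fin.elim0 p.1
    rw [h0]
    simp [Real.zero_rpow (by norm_num : (2 : ℝ) / 3 ≠ 0), Real.zero_rpow (by norm_num : (3 : ℝ) / 4 ≠ 0)]
  obtain ⟨kmin, kmax, n, d, b, hkk, hsupp, hsum, hd0, hd, hb1, hb2, hC⟩ :=
    layerProfileSharp σ hσ x hx hmem hNpos
  have hb2' : ∀ κ, 1 / 2 * |(n κ : ℝ) - n (κ + 1)| +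
      Real.sqrt 2 * Real.sqrt (max (n κ : ℝ) (n (κ + 1))) - 1 / 2 ≤ b κ := by
    intro κ
    have h := hb2 κ
    rw [Real.sqrt_mul (by norm_num : (0 : ℝ) ≤ 2)] at h
    linarith
  have sqrt2_ge : (1.41421 : ℝ) ≤ Real.sqrt 2 := by
    rw [show (1.41421 : ℝ) = Real.sqrt (1.41421 ^ 2) by rw [Real.sqrt_sq (by norm_num)]]
    exact Real.sqrt_le_sqrt (by norm_num)
  have sqrt2_le : Real.sqrt 2 ≤ 1.41422 := by
    rw [show (1.41422 : ℝ) = Real.sqrt (1.41422 ^ 2) by rw [Real.sqrt_sq (by norm_num)]]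
    exact Real.sqrt_le_sqrt (by norm_num)
  have hs2 := sqrt2_ge; have hs2' := sqrt2_le
  have h := profile_bound_opt hNpos (c := Real.sqrt 2) (δ := 1 / 2) (by positivity)
    (by nlinarith) (by norm_num) (by nlinarith) (by nlinarith) hkk hsupp hsum hd0 hd hb1 hb2' hC
  rw [ceiling_sqrt2] at h
  have hsN : 0 ≤ Real.sqrt (N : ℝ) := Real.sqrt_nonneg _
  have hco := coeff_sqrt2_le
  have hK'8 : (Real.sqrt 2 + 2 * Real.sqrt 3 / Real.sqrt 2 +
      4 * (2 * Real.sqrt 3 + Real.sqrt 2) / (Real.sqrt 2 * Real.sqrt 31)) ≤ 8 := by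
    have : 0 ≤ 1 / 2 + Real.sqrt 3 / (2 * Real.sqrt 31) := by positivity
    linarith
  have hm2 : 3 * (N : ℝ) ^ ((3 : ℝ) / 4) - 8 * Real.sqrt N ≤
      3 * (N : ℝ) ^ ((3 : ℝ) / 4) -
        (Real.sqrt 2 + 2 * Real.sqrt 3 / Real.sqrt 2 +
          4 * (2 * Real.sqrt 3 + Real.sqrt 2) / (Real.sqrt 2 * Real.sqrt 31)) * Real.sqrt N := by
    nlinarith [mul_le_mul_of_nonneg_right hK'8 hsN]
  have hm3 : (531 / 2 + 54 * Real.sqrt 6) ^ ((1 : ℝ) / 3) * (N : ℝ) ^ ((2 : ℝ) / 3) - 8 * Real.sqrt N ≤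
      (531 / 2 + 54 * Real.sqrt 6) ^ ((1 : ℝ) / 3) * (N : ℝ) ^ ((2 : ℝ) / 3) -
        (1 / 2 + Real.sqrt 3 / (2 * Real.sqrt 31) +
          (Real.sqrt 2 + 2 * Real.sqrt 3 / Real.sqrt 2 +
            4 * (2 * Real.sqrt 3 + Real.sqrt 2) / (Real.sqrt 2 * Real.sqrt 31))) * Real.sqrt N := by
    nlinarith [mul_le_mul_of_nonneg_right hco hsN]
  have hmin := min_le_min (le_refl (3 / 5 * (N : ℝ))) (min_le_min hm2 hm3)
  linarith [hmin, h]

/-- From the explicit three-way bound to the ε-form: if `K ≤ 398`, `N ≥ 50000` and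
`(8/ε)^6 ≤ N`, then `(K^{1/3} − ε)N^{2/3} ≤ min(3N/5, 3N^{3/4} − 8√N, K^{1/3}N^{2/3} − 8√N)`. -/
theorem eps_rpow_le_min3 {K ε : ℝ} (hK0 : 0 ≤ K) (hK : K ≤ 398) (hε : 0 < ε) {N : ℝ}
    (hN1 : 50000 ≤ N) (hN2 : (1 / (ε / 8)) ^ 6 ≤ N) :
    (K ^ ((1 : ℝ) / 3) - ε) * N ^ ((2 : ℝ) / 3) ≤
      min (3 / 5 * N) (min (3 * N ^ ((3 : ℝ) / 4) - 8 * Real.sqrt N)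
        (K ^ ((1 : ℝ) / 3) * N ^ ((2 : ℝ) / 3) - 8 * Real.sqrt N)) := by
  have hN0 : 0 ≤ N := by linarith
  have hP : (0 : ℝ) ≤ N ^ ((2 : ℝ) / 3) := by positivity
  have hA := cbrt_rpow_le (K := K) (N := N) hK0 (by linarith)
  have hK4 : K ^ 4 ≤ 3 ^ 12 * N := by
    have h1 : K ^ 4 ≤ (398 : ℝ) ^ 4 := pow_le_pow_left₀ hK0 hK 4
    nlinarith
  have hB := cbrt_rpow_le_three_rpow34 hK0 hN0 hK4
  have hC := sqrt_le_eps_mul_rpow (by positivity : 0 < ε / 8) hN2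
  refine le_min ?_ (le_min ?_ ?_)
  · nlinarith
  · nlinarith
  · nlinarith

/-- **The exact-ceiling rung `∛(1017/4 + 54√3) = 7.0324…` in the shape of the crux `StackingLiminf`**
(from `layerProfile` alone; vs the crux's `∛432 = 7.5595…`): for every `ε > 0` there is `N₀`,
independent of the Hägg word, such that every injective `N`-point configuration (`N ≥ N₀`) on any
Barlow stacking has `((1017/4 + 54√3)^{1/3} − ε)N^{2/3} ≤ 6N − numContacts`. -/
theorem stackingLiminf_rung_opt_one :
    ∀ ε : ℝ, 0 < ε → ∃ N₀ : ℕ, ∀ N : ℕ, N₀ ≤ N → ∀ σ : ℤ → ℤ, IsHaggSeq σ →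
      ∀ x : Fin N → EuclideanSpace ℝ (Fin 3), Function.Injective x →
        (∀ i, x i ∈ barlowStacking 1 (Real.sqrt (2 / 3)) σ) →
          ((1017 / 4 + 54 * Real.sqrt 3) ^ ((1 : ℝ) / 3) - ε) * (N : ℝ) ^ ((2 : ℝ) / 3) ≤
            6 * (N : ℝ) - (numContacts x : ℝ) := by
  intro ε hε
  obtain ⟨N₁, hN₁⟩ := exists_nat_ge ((1 / (ε / 8)) ^ 6)
  refine ⟨max 50000 N₁, fun N hN σ hσ x hx hmem => ?_⟩
  have hmain := numContacts_le_opt_one σ hσ x hx hmem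
  have hN1 : (50000 : ℝ) ≤ N := by exact_mod_cast (le_max_left _ _).trans hN
  have hN2 : (1 / (ε / 8)) ^ 6 ≤ (N : ℝ) :=
    hN₁.trans (by exact_mod_cast (le_max_right _ _).trans hN)
  have hK0 : (0 : ℝ) ≤ 1017 / 4 + 54 * Real.sqrt 3 := by positivity
  have h := eps_rpow_le_min3 hK0 (by linarith [ceiling_one_le]) hε hN1 hN2
  linarith

/-- **The exact-ceiling rung `∛(531/2 + 54√6) = 7.3544…` in the shape of the crux `StackingLiminf`**
(from `layerProfileSharp`; 97.3 % of the crux's `∛432 = 7.5595…`): for every `ε > 0` there is `N₀`,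
independent of the Hägg word, such that every injective `N`-point configuration (`N ≥ N₀`) on any
Barlow stacking has `((531/2 + 54√6)^{1/3} − ε)N^{2/3} ≤ 6N − numContacts`. -/
theorem stackingLiminf_rung_opt_sqrt2 :
    ∀ ε : ℝ, 0 < ε → ∃ N₀ : ℕ, ∀ N : ℕ, N₀ ≤ N → ∀ σ : ℤ → ℤ, IsHaggSeq σ →
      ∀ x : Fin N → EuclideanSpace ℝ (Fin 3), Function.Injective x →
        (∀ i, x i ∈ barlowStacking 1 (Real.sqrt (2 / 3)) σ) →
          ((531 / 2 + 54 * Real.sqrt 6) ^ ((1 : ℝ) / 3) - ε) * (N : ℝ) ^ ((2 : ℝ) / 3) ≤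
            6 * (N : ℝ) - (numContacts x : ℝ) := by
  intro ε hε
  obtain ⟨N₁, hN₁⟩ := exists_nat_ge ((1 / (ε / 8)) ^ 6)
  refine ⟨max 50000 N₁, fun N hN σ hσ x hx hmem => ?_⟩
  have hmain := numContacts_le_opt_sqrt2 σ hσ x hx hmem
  have hN1 : (50000 : ℝ) ≤ N := by exact_mod_cast (le_max_left _ _).trans hN
  have hN2 : (1 / (ε / 8)) ^ 6 ≤ (N : ℝ) :=
    hN₁.trans (by exact_mod_cast (le_max_right _ _).trans hN)
  have hK0 : (0 : ℝ) ≤ 531 / 2 + 54 * Real.sqrt 6 := by positivity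
  have h := eps_rpow_le_min3 hK0 (by linarith [ceiling_sqrt2_le]) hε hN1 hN2
  linarith

/-- Integer-rounded corollary: the `∛347` rung (`= 7.027`) from `layerProfile` alone. -/
theorem stackingLiminf_rung_cbrt347 :
    ∀ ε : ℝ, 0 < ε → ∃ N₀ : ℕ, ∀ N : ℕ, N₀ ≤ N → ∀ σ : ℤ → ℤ, IsHaggSeq σ →
      ∀ x : Fin N → EuclideanSpace ℝ (Fin 3), Function.Injective x →
        (∀ i, x i ∈ barlowStacking 1 (Real.sqrt (2 / 3)) σ) →
          ((347 : ℝ) ^ ((1 : ℝ) / 3) - ε) * (N : ℝ) ^ ((2 : ℝ) / 3) ≤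
            6 * (N : ℝ) - (numContacts x : ℝ) := by
  intro ε hε
  obtain ⟨N₀, hN₀⟩ := stackingLiminf_rung_opt_one ε hε
  refine ⟨N₀, fun N hN σ hσ x hx hmem => ?_⟩
  have h := hN₀ N hN σ hσ x hx hmem
  have sqrt3_ge : (1.73205 : ℝ) ≤ Real.sqrt 3 := by
    rw [show (1.73205 : ℝ) = Real.sqrt (1.73205 ^ 2) by rw [Real.sqrt_sq (by norm_num)]]
    exact Real.sqrt_le_sqrt (by norm_num)
  have hK : (347 : ℝ) ^ ((1 : ℝ) / 3) ≤ (1017 / 4 + 54 * Real.sqrt 3) ^ ((1 : ℝ) / 3) :=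
    Real.rpow_le_rpow (by norm_num) (by linarith) (by norm_num)
  have hP : (0 : ℝ) ≤ (N : ℝ) ^ ((2 : ℝ) / 3) := by positivity
  nlinarith [mul_le_mul_of_nonneg_right hK hP]

/-- Integer-rounded corollary: the `∛397` rung (`= 7.350`) from `layerProfileSharp`. -/
theorem stackingLiminf_rung_cbrt397 :
    ∀ ε : ℝ, 0 < ε → ∃ N₀ : ℕ, ∀ N : ℕ, N₀ ≤ N → ∀ σ : ℤ → ℤ, IsHaggSeq σ →
      ∀ x : Fin N → EuclideanSpace ℝ (Fin 3), Function.Injective x →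
        (∀ i, x i ∈ barlowStacking 1 (Real.sqrt (2 / 3)) σ) →
          ((397 : ℝ) ^ ((1 : ℝ) / 3) - ε) * (N : ℝ) ^ ((2 : ℝ) / 3) ≤
            6 * (N : ℝ) - (numContacts x : ℝ) := by
  intro ε hε
  obtain ⟨N₀, hN₀⟩ := stackingLiminf_rung_opt_sqrt2 ε hε
  refine ⟨N₀, fun N hN σ hσ x hx hmem => ?_⟩
  have h := hN₀ N hN σ hσ x hx hmem
  have sqrt6_ge : (2.4494 : ℝ) ≤ Real.sqrt 6 := by
    rw [show (2.4494 : ℝ) = Real.sqrt (2.4494 ^ 2) by rw [Real.sqrt_sq (by norm_num)]]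
    exact Real.sqrt_le_sqrt (by norm_num)
  have hK : (397 : ℝ) ^ ((1 : ℝ) / 3) ≤ (531 / 2 + 54 * Real.sqrt 6) ^ ((1 : ℝ) / 3) :=
    Real.rpow_le_rpow (by norm_num) (by linarith) (by norm_num)
  have hP : (0 : ℝ) ≤ (N : ℝ) ^ ((2 : ℝ) / 3) := by positivity
  nlinarith [mul_le_mul_of_nonneg_right hK hP]

end Summit.Ventures.Crystal3D.Theorems.OptimalCalibration

end
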